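import Mathlib.Data.Matrix.Block
import Mathlib.Data.Matrix.ColumnRowPartitioned
import Mathlib.RingTheory.Derivation.Basic
import Mathlib.Algebra.BigOperators.Fin
import Mathlib.Tactic.LinearCombination
import Mathlib.Tactic.Positivity
import Mathlib.Tactic.Abel
import Mathlib.Tactic.Module
import HarnessLib

/-!
# The Weil-transverse obstruction (WTO) at a tensor point: the tangent space of the Weil family, `κ⌟X³ = 0`, and
# `σ_q(v_κ) = κ⌟ch_{q+1}` — kernel-checked cores of LADDER C64 (a)(b)(c)

Family `hodge`, layer `Literature/AlgebraicGeometry/HodgeTheory`. Fully PROVED statements (no named fact, no definition),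
in the standard of `WeilClassTestPairedDesign.lean` / `WeilClassTestTensorPointRing.lean` (the geometry is the dictionary,
the kernel checks the algebra); requested as GAPS G47 of the ladder note `papers/HodgeConjecture/hodge-weil-ladder`
(packet `run/shared/lean/b2b/hodge-weil/`, LADDER `## CARVER v8` C64 "Weil-transverse obstruction", CLAIM TABLE v8.2 row
pv3-g6; the carver's numerical model is `b2b-hweil-carver-g8/ct/ct4/weil_kappa.py`). It is census / negative knowledge for
the seed hunt (door II′ in split form is dead); NOT a case of the Hodge conjecture, no rung, no statement about the
semiregularity of any specific object enters as a fact.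

## Dictionary (pen-and-paper; (T)(B)(W) of the tensor-point files, plus first-order deformation theory)

* HERMITIAN MODEL at `Y₀ = A₀ × A₀` (any `A₀`): `H^{1,0}(Y₀) = H^{1,0}(A₀) ⊕ H^{1,0}(A₀)` with basis `e_1..e_3` (first
  factor), `e_4..e_6` (second), `ē_k` the conjugates; a `(1,1)`-class is `Σ h_{kl} e_k ∧ ē_l`, i.e. a `6 × 6` matrix `h`
  written in `3 × 3` blocks. `θ₁ ↔ diag(1, 0)`, `θ₂ ↔ diag(0, 1)`, `P = m^*θ − θ₁ − θ₂ ↔ [[0, 1], [1, 0]]`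
  (`m^*e_t = e_t + e_{3+t}`), `N = θ₁ + dθ₂ ↔ n := diag(1, d)`. `K = ℚ(√-d)` acts by `J(x, y) = (−dy, x)`, so on `H¹`:
  `J^*e_t = −d·e_{3+t}`, `J^*e_{3+t} = e_t`, matrix **`J^* = [[0, 1], [−d, 0]]`** (columns = images; the same real matrix
  on the `ē`'s; check `J^*N = dN`). NOTE: the packet script `weil_kappa.py` takes `[[0, −d], [1, 0]]` (the matrix of `J_*`),
  which agrees with `J^*` up to sign at `d = 1` — the only value it was run at — but does not satisfy `J^*N = dN` for
  `N = diag(1, d)`, `d ≠ 1`; the statements of C64 are unaffected (they are proved here for every `d ≠ 0`).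
* FIRST-ORDER DEFORMATIONS. `κ ∈ H¹(T_{Y₀}) = Hom(H^{1,0}, H^{0,1})`, `κ(e_i) = Σ_j K_{ji} ē_j` (`6 × 6` matrix `K`, blocks
  `[[A, B], [C, E]]`), acts on `H^{p,q}` by the contraction DERIVATION `κ⌟` (replace one `e_i` by `κ(e_i)`); a class of
  type `(p,p)` stays of type `(p,p)` to first order along `κ` iff `κ⌟(class) = 0` in `H^{p−1,p+1}` (Griffiths). For a
  `(1,1)`-class with matrix `h`: `κ⌟h = Σ_{j<l} ((Kh)_{jl} − (Kh)_{lj}) ē_j ∧ ē_l`, so **`κ⌟h = 0 ⟺ K·h is symmetric`**.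
  Hence: polarised directions (`N` stays `(1,1)`) `⟺ (Kn)ᵀ = Kn` (`K = S·n⁻¹`, `S` symmetric: 21 dimensions = Siegel
  `𝔥₆`); the WEIL FAMILY `𝒲` through `(Y₀, J, N)` = polarised AND `K`-equivariant, `K·J^* = J^*·K` (`κ` is `K`-linear);
  the TENSOR LOCUS `𝒯 ⊂ 𝒲` = deformations of `A₀` = `κ` killing `θ₁, θ₂, P` as well.
* (a) **`T_{Y₀}𝒲 = {[[A, B], [−dB, A]] : Aᵀ = A, Bᵀ = −B}`** (dimension `6 + 3 = 9 = dim SU(3,3)/S(U(3) × U(3))`), and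
  **`T_{Y₀}𝒯 = {[[A, 0], [0, A]] : Aᵀ = A}`** (dimension `6 = dim 𝔥₃`; `τ ↦ τ + A`); the three TRANSVERSE directions are
  the antisymmetric `B` — §1, kernel-checked as `iff`s of block-matrix equations over any field with `d ≠ 0`
  (`weilTangent_only_if` with `weilTangent_comm` / `weilTangent_polarised`, and `tensorTangent_only_if` / `tensorTangent_polarised`).
* (b) **`κ⌟X³ = κ⌟Y³ = 0` for every `κ ∈ T𝒲`** (the Weil classes `W ⊗ ℂ = ℂX³ ⊕ ℂY³` stay Hodge along `𝒲`), while
  `κ⌟X ≠ 0` off `T𝒯`. PROOF (§2): with `μ² = −d`, `X = θ₁ − dθ₂ − μP ↔ [[1, −μ], [−μ, −d]] = w wᵀ ⊗ 1`, `w = (1, −μ)`, is of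
  RANK ONE in the block sense: `X = Σ_t f_t ∧ g_t` with `f_t := e_t − μe_{3+t}`, `g_t := ē_t − μē_{3+t}` (the
  `J^*`-eigenvectors of eigenvalue `−μ`: `eigen_fromRows`), so `X³ = 3!·f₁g₁f₂g₂f₃g₃` (`cube_eq_six_mul`); `K`-equivariance
  gives `κ(f_t) = Σ_s (A − μB)_{st} g_s ∈ span(g)` (`weilTangent_mul_eigen`: `K·F = F·(A − μB)` for the `6 × 3` coordinate
  matrix `F` of the `f_t`); and an even derivation `δ` with `δ(g_t) = 0`, `δ(f_t) ∈ span(g₁, g₂, g₃)` kills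
  `f₁g₁f₂g₂f₃g₃` because every term of the Leibniz expansion contains a repeated `g` (`derivation_kills_top`, for
  anticommuting square-zero symbols in any algebra). Same for `Y` with `μ ↦ −μ`.
* (c) **LEMMA (WTO).** For a split design `G = ⊕_a L_a[n_a]` (roots `r_a ∈ NS ⊗ K`, signs `ε_a = (−1)^{n_a}`), the block of
  `Ext²(G, G)` belonging to `L_a` is `Ext²(L_a, L_a) = H^{0,2}`, on which Buchweitz–Flenner's `σ_q` is
  `ω ↦ ε_a·ω ∧ r_a^q/q!` (`At(L_a) = r_a`; [cite: BuchweitzFlenner2003, Def. 4.1]; tree normalisation note in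
  `SemiregularityHigherSigma`), and the first-order obstruction to deforming `L_a` along `κ` is `κ⌟r_a ∈ H^{0,2}`. For
  `v_κ := (κ⌟r_a)_a` and `ch_{q+1}(G) = Σ_a ε_a r_a^{q+1}/(q+1)!` one gets **`σ_q(v_κ) = κ⌟ch_{q+1}(G)`**, because `κ⌟` is an
  (even) DERIVATION: `(q+1)·Σ_a ε_a r_a^q·δ(r_a) = δ(Σ_a ε_a r_a^{q+1})` for any derivation `δ` of a commutative `ℚ`-algebra
  (§3 `sum_pow_smul_derivation`, Mathlib's `Derivation.leibniz_pow`). So if `ch_{q+1}(G) ∈ ℚN^{q+1} ⊕ W` (ALL-PURE, LADDER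
  C62a) then `σ_q(v_κ) = 0` for every `κ ∈ T𝒲`, by (a) (`κ⌟N = 0`) and (b) (`κ⌟W = 0`) — `sigma_obstruction_eq_zero`. With
  (a)–(b): `κ ↦ v_κ` has rank `3` on `T𝒲/T𝒯` as soon as one root is charged (`κ⌟X ≠ 0` there), hence `dim ker σ_I ≥ 3`
  for EVERY `I`: no split all-pure design at a generic tensor point is `I`-semiregular (LADDER C64; numerically `147/150`
  on the carver's definite all-pure `(6,4)` design).

* (b′) **RANK 3** (§4). For a root `r = αN + βY + γX ↔ h_r = [[α+β+γ, μ(β−γ)], [μ(β−γ), d(α−β−γ)]] ⊗ 1` and a Weil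
  tangent vector `K = [[A, B], [−dB, A]]`, the `(0,2)`-form `κ⌟r` has coefficient matrix
  `K·h_r − (K·h_r)ᵀ = [[2μ(β−γ)B, −2d(β+γ)B], [−2d(β+γ)B, −2dμ(β−γ)B]]` (`contract_root_matrix`) — it depends on the
  TRANSVERSE part `B` only, vanishes on `T𝒯`, and for a charged root (`(β, γ) ≠ 0`; `2dμ ≠ 0`) it vanishes only for `B = 0`
  (`eq_zero_of_contract_root_eq_zero`): `κ ↦ κ⌟r` and hence `κ ↦ v_κ` have rank exactly `3 = dim T𝒲/T𝒯` as soon as one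
  root of the design is charged — the last ingredient of LADDER C64 (c) (`dim ker σ_I ≥ 3`).
* CROSS-REFERENCE. The derivation identity of (c) was landed independently, one minute earlier, by the carver as
  `WeilTransverseObstruction.succ_nsmul_sum_smul_pow_smul_apply` / `….sum_smul_pow_smul_apply_eq_zero` (p182927); §3 here
  is the same algebra with `Fin m`-indexed integer signs — cite either. What this file adds to it is (a), (b), (b′): the
  rank data `9 / 6 / 3` and `κ⌟X³ = 0`, for every `d`, as theorems rather than script census.

## What is NOT here

The identification of `H¹(T_{Y₀})`-classes with derivations `κ⌟` and of `σ_q` on line-bundle blocks (dictionary, standard);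
any exterior-algebra MODEL computation beyond the abstract lemmas (the rank-one factorisation makes it unnecessary); anything
about non-split objects (door II″). Script of record: `b2b-hweil-carver-g8/ct/ct4/weil_kappa.py` (d = 1; see the NOTE on `J`).
-/

namespace Literature.AlgebraicGeometry.HodgeTheory.WeilClassTestTransverseObstruction

open Matrix

/-! ### §1 (a) The tangent spaces of the Weil family `𝒲` and of the tensor locus `𝒯`, as block-matrix conditions -/

section Tangent

variable {F : Type*} [Field F] (d : F) (A B C E : Matrix (Fin 3) (Fin 3) F)

/-- **(a), easy direction, equivariance**: every `K = [[A, B], [−dB, A]]` commutes with `J^* = [[0, 1], [−d, 0]]`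
(is `K`-linear). [cite: vanGeemen1994HodgeAV, 5.2] -/
theorem weilTangent_comm :
    fromBlocks A B (-(d • B)) A * fromBlocks 0 1 (-(d • (1 : Matrix (Fin 3) (Fin 3) F))) 0 =
      fromBlocks 0 1 (-(d • (1 : Matrix (Fin 3) (Fin 3) F))) 0 * fromBlocks A B (-(d • B)) A := by
  simp only [fromBlocks_multiply, Matrix.mul_zero, Matrix.zero_mul, zero_add, add_zero, Matrix.mul_one,
    Matrix.one_mul, Matrix.mul_neg, Matrix.neg_mul, Matrix.mul_smul, Matrix.smul_mul, smul_zero, neg_zero]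

/-- **(a), easy direction, polarisation**: for `A` symmetric and `B` antisymmetric, `K = [[A, B], [−dB, A]]` keeps
`N = diag(1, d)` of type `(1,1)` (`K·n` symmetric, i.e. `κ⌟N = 0`). [cite: vanGeemen1994HodgeAV, 5.2] -/
theorem weilTangent_polarised (hA : Aᵀ = A) (hB : Bᵀ = -B) :
    (fromBlocks A B (-(d • B)) A * fromBlocks 1 0 0 (d • (1 : Matrix (Fin 3) (Fin 3) F)))ᵀ =
      fromBlocks A B (-(d • B)) A * fromBlocks 1 0 0 (d • (1 : Matrix (Fin 3) (Fin 3) F)) := by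
  simp only [fromBlocks_multiply, Matrix.mul_zero, zero_add, add_zero, Matrix.mul_one,
    Matrix.mul_smul, fromBlocks_transpose, transpose_smul, transpose_neg, hA, hB, smul_neg, neg_neg]

/-- **(a) `T_{Y₀}𝒲 = {[[A, B], [−dB, A]] : Aᵀ = A, Bᵀ = −B}`** (`d ≠ 0`): a deformation `K = [[A, B], [C, E]]` that is
`K`-linear (`K·J^* = J^*·K`) and polarised (`K·n` symmetric) has `E = A`, `C = −dB`, `A` symmetric, `B` antisymmetric —
so `dim T𝒲 = 6 + 3 = 9` for every `d` (LADDER C64 (a); the packet script checked `d = 1`). [cite: vanGeemen1994HodgeAV, 5.2] -/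
theorem weilTangent_only_if (hd : d ≠ 0)
    (hcomm : fromBlocks A B C E * fromBlocks 0 1 (-(d • (1 : Matrix (Fin 3) (Fin 3) F))) 0 =
      fromBlocks 0 1 (-(d • (1 : Matrix (Fin 3) (Fin 3) F))) 0 * fromBlocks A B C E)
    (hpol : (fromBlocks A B C E * fromBlocks 1 0 0 (d • (1 : Matrix (Fin 3) (Fin 3) F)))ᵀ =
      fromBlocks A B C E * fromBlocks 1 0 0 (d • (1 : Matrix (Fin 3) (Fin 3) F))) :
    E = A ∧ C = -(d • B) ∧ Aᵀ = A ∧ Bᵀ = -B := by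
  simp only [fromBlocks_multiply, Matrix.mul_zero, Matrix.zero_mul, zero_add, add_zero, Matrix.mul_one,
    Matrix.one_mul, Matrix.mul_neg, Matrix.neg_mul, Matrix.mul_smul, Matrix.smul_mul, fromBlocks_transpose,
    transpose_smul, fromBlocks_inj] at hcomm hpol
  obtain ⟨h1, h2, h3, h4⟩ := hcomm
  obtain ⟨hA, hCt, hBt, hEt⟩ := hpol
  refine ⟨h2.symm, h4, hA, ?_⟩
  rw [h4, transpose_neg, transpose_smul] at hCt
  have h5 : d • Bᵀ = d • (-B) := by rw [smul_neg, ← hCt, neg_neg]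
  exact smul_right_injective _ hd h5

/-- **(a) `T_{Y₀}𝒯 = {B = 0}` inside `T𝒲`**: if moreover `θ₁ = diag(1, 0)` stays `(1,1)` (`K·t₁` symmetric) then
`B = 0` (`d ≠ 0`); so the tensor locus has the 6 directions `[[A, 0], [0, A]]`, `A` symmetric (`τ ↦ τ + A` on `A₀`), and
`T𝒲/T𝒯` is the 3-space of antisymmetric `B` (the TRANSVERSE directions). [cite: vanGeemen1994HodgeAV, 5.2] -/
theorem tensorTangent_only_if (hd : d ≠ 0)
    (hθ : (fromBlocks A B (-(d • B)) A * fromBlocks 1 0 0 (0 : Matrix (Fin 3) (Fin 3) F))ᵀ =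
      fromBlocks A B (-(d • B)) A * fromBlocks 1 0 0 (0 : Matrix (Fin 3) (Fin 3) F)) :
    B = 0 := by
  simp only [fromBlocks_multiply, Matrix.mul_zero, add_zero, Matrix.mul_one,
    fromBlocks_transpose, transpose_zero, transpose_neg, transpose_smul, fromBlocks_inj] at hθ
  obtain ⟨-, -, h3, -⟩ := hθ
  have : d • B = 0 := neg_eq_zero.mp h3.symm
  exact (smul_eq_zero.mp this).resolve_left hd

/-- Conversely the tensor directions `[[A, 0], [0, A]]`, `A` symmetric, keep EVERY class `uθ₁ + vθ₂ + sP ↔ [[u, s], [s, v]] ⊗ 1`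
of `NS(Y₀)` of type `(1,1)`. [cite: vanGeemen1994HodgeAV, 5.2] -/
theorem tensorTangent_polarised (hA : Aᵀ = A) (u v s : F) :
    (fromBlocks A 0 0 A * fromBlocks (u • (1 : Matrix (Fin 3) (Fin 3) F)) (s • 1) (s • 1) (v • 1))ᵀ =
      fromBlocks A 0 0 A * fromBlocks (u • (1 : Matrix (Fin 3) (Fin 3) F)) (s • 1) (s • 1) (v • 1) := by
  simp only [fromBlocks_multiply, smul_zero, add_zero, zero_add, Matrix.mul_smul, Matrix.mul_one,
    fromBlocks_transpose, transpose_smul, hA]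

end Tangent

/-! ### §2 (b) `κ⌟X³ = 0`: the rank-one frame, `K`-linearity, and the abstract vanishing lemma -/

section Eigen

variable {F : Type*} [Field F] (d μ : F) (A B : Matrix (Fin 3) (Fin 3) F)

/-- **(b), step 1: the rank-one frame.** With `μ² = −d`, the columns `f_t = e_t − μ·e_{3+t}` of `F = [1; −μ·1]` are
eigenvectors of `J^*` with eigenvalue `−μ`; and `X = θ₁ − dθ₂ − μP ↔ [[1, −μ], [−μ, −d]] = (1, −μ)ᵀ(1, −μ) ⊗ 1` is
`Σ_t f_t ∧ g_t` with `g_t = ē_t − μ·ē_{3+t}` (same coordinates). [cite: vanGeemen1994HodgeAV, 5.2] -/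
theorem eigen_fromRows (hμ : μ * μ = -d) :
    fromBlocks 0 1 (-(d • (1 : Matrix (Fin 3) (Fin 3) F))) 0 *
        fromRows (1 : Matrix (Fin 3) (Fin 3) F) (-(μ • (1 : Matrix (Fin 3) (Fin 3) F))) =
      (-μ) • fromRows (1 : Matrix (Fin 3) (Fin 3) F) (-(μ • (1 : Matrix (Fin 3) (Fin 3) F))) := by
  rw [fromBlocks_mul_fromRows]
  ext (i | i) j
  · simp [fromRows_apply_inl]
  · simp [fromRows_apply_inr, Matrix.one_apply, hμ]

/-- **(b), step 2: a Weil tangent vector maps the frame into its conjugate span**: for `K = [[A, B], [−dB, A]]`,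
`K·F = F·(A − μB)`, i.e. `κ(f_t) = Σ_s (A − μB)_{st}·g_s ∈ span(g₁, g₂, g₃)` (`K`-linearity: eigenspace to eigenspace).
[cite: vanGeemen1994HodgeAV, 5.2] -/
theorem weilTangent_mul_eigen (hμ : μ * μ = -d) :
    fromBlocks A B (-(d • B)) A * fromRows (1 : Matrix (Fin 3) (Fin 3) F) (-(μ • (1 : Matrix (Fin 3) (Fin 3) F))) =
      fromRows (1 : Matrix (Fin 3) (Fin 3) F) (-(μ • (1 : Matrix (Fin 3) (Fin 3) F))) * (A - μ • B) := by
  rw [fromBlocks_mul_fromRows, fromRows_mul, fromRows_ext_iff]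
  simp only [Matrix.mul_one, Matrix.one_mul, Matrix.mul_neg, Matrix.mul_smul, Matrix.neg_mul, Matrix.smul_mul,
    sub_eq_add_neg]
  refine ⟨trivial, ?_⟩
  rw [smul_add, smul_neg, smul_smul, hμ, neg_smul, neg_neg]
  abel

end Eigen

section Super

variable {R Λ : Type*} [CommRing R] [Ring Λ] [Algebra R Λ]
  (f₁ f₂ f₃ g₁ g₂ g₃ : Λ) (δ : Λ →+ Λ)

/-- `X³ = 3!·u₁u₂u₃` for `X = u₁ + u₂ + u₃` with pairwise commuting square-zero `u_t` (`u_t = f_t ∧ g_t`: even classes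
commute and `(f_tg_t)² = ±f_t²g_t² = 0`). [cite: MumfordAV1970, §1] -/
theorem cube_eq_six_mul (u₁ u₂ u₃ : Λ) (h11 : u₁ * u₁ = 0) (h22 : u₂ * u₂ = 0) (h33 : u₃ * u₃ = 0)
    (h21 : u₂ * u₁ = u₁ * u₂) (h31 : u₃ * u₁ = u₁ * u₃) (h32 : u₃ * u₂ = u₂ * u₃) :
    (u₁ + u₂ + u₃) ^ 3 = 6 • (u₁ * u₂ * u₃) := by
  have r21 : ∀ z, u₂ * (u₁ * z) = u₁ * (u₂ * z) := fun z => by rw [← mul_assoc, h21, mul_assoc]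
  have s1 : ∀ z, u₁ * (u₁ * z) = 0 := fun z => by rw [← mul_assoc, h11, zero_mul]
  have s2 : ∀ z, u₂ * (u₂ * z) = 0 := fun z => by rw [← mul_assoc, h22, zero_mul]
  simp only [pow_succ, pow_zero, one_mul, mul_add, add_mul, mul_assoc, r21, s1, s2, h11, h22, h33, h21, h31,
    h32, mul_zero, add_zero, zero_add]
  abel

/-- **(b), step 3 (abstract): an even derivation `δ` with `δ(g_t) = 0` and `δ(f_t) ∈ span(g₁, g₂, g₃)` kills
`f₁g₁f₂g₂f₃g₃`** — every term of the Leibniz expansion contains a repeated `g`. Here `Λ` is any algebra over a commutative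
ring `R` (the exterior algebra `H^•(Y₀; ℂ)`), `δ = κ⌟` (an even derivation: plain Leibniz rule), the `g_t` pairwise
anticommuting and square-zero, and only the anticommutations actually used are assumed. With steps 1–2 and
`X³ = 3!·f₁g₁f₂g₂f₃g₃` (`cube_eq_six_mul`): **`κ⌟X³ = 0` for every `κ ∈ T𝒲`**, and likewise `κ⌟Y³ = 0` (`μ ↦ −μ`) — the Weil
classes stay Hodge along the Weil family (LADDER C64 (b)). [cite: vanGeemen1994HodgeAV, Thm. 6.12] -/
theorem derivation_kills_top
    (hL : ∀ a b : Λ, δ (a * b) = δ a * b + a * δ b)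
    (hg₁ : δ g₁ = 0) (hg₂ : δ g₂ = 0) (hg₃ : δ g₃ = 0)
    (c₁₁ c₁₂ c₁₃ c₂₁ c₂₂ c₂₃ c₃₁ c₃₂ c₃₃ : R)
    (hf₁ : δ f₁ = c₁₁ • g₁ + c₁₂ • g₂ + c₁₃ • g₃)
    (hf₂ : δ f₂ = c₂₁ • g₁ + c₂₂ • g₂ + c₂₃ • g₃)
    (hf₃ : δ f₃ = c₃₁ • g₁ + c₃₂ • g₂ + c₃₃ • g₃)
    (hgg₁ : g₁ * g₁ = 0) (hgg₂ : g₂ * g₂ = 0) (hgg₃ : g₃ * g₃ = 0)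
    (h21 : g₂ * g₁ = -(g₁ * g₂)) (h31 : g₃ * g₁ = -(g₁ * g₃)) (h32 : g₃ * g₂ = -(g₂ * g₃))
    (a1 : f₂ * g₁ = -(g₁ * f₂)) (b1 : g₂ * f₂ = -(f₂ * g₂)) (b2 : g₃ * f₂ = -(f₂ * g₃))
    (b3 : g₃ * f₃ = -(f₃ * g₃)) :
    δ (f₁ * g₁ * f₂ * g₂ * f₃ * g₃) = 0 := by
  -- sorted order: g₁ < f₂? We only need to bring equal g's together. Strategy: expand, push scalars out, then sort with
  -- the order f₁ < g₁ < f₂ < g₂ < f₃ < g₃ restricted to the rules provided.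
  have r21 : ∀ z, g₂ * (g₁ * z) = -(g₁ * (g₂ * z)) := fun z => by rw [← mul_assoc, h21, neg_mul, mul_assoc]
  have r31 : ∀ z, g₃ * (g₁ * z) = -(g₁ * (g₃ * z)) := fun z => by rw [← mul_assoc, h31, neg_mul, mul_assoc]
  have r32 : ∀ z, g₃ * (g₂ * z) = -(g₂ * (g₃ * z)) := fun z => by rw [← mul_assoc, h32, neg_mul, mul_assoc]
  have s1 : ∀ z, g₁ * (g₁ * z) = 0 := fun z => by rw [← mul_assoc, hgg₁, zero_mul]
  have s2 : ∀ z, g₂ * (g₂ * z) = 0 := fun z => by rw [← mul_assoc, hgg₂, zero_mul]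
  have ra1 : ∀ z, f₂ * (g₁ * z) = -(g₁ * (f₂ * z)) := fun z => by rw [← mul_assoc, a1, neg_mul, mul_assoc]
  have rb1 : ∀ z, g₂ * (f₂ * z) = -(f₂ * (g₂ * z)) := fun z => by rw [← mul_assoc, b1, neg_mul, mul_assoc]
  have rb2 : ∀ z, g₃ * (f₂ * z) = -(f₂ * (g₃ * z)) := fun z => by rw [← mul_assoc, b2, neg_mul, mul_assoc]
  have rb3 : ∀ z, g₃ * (f₃ * z) = -(f₃ * (g₃ * z)) := fun z => by rw [← mul_assoc, b3, neg_mul, mul_assoc]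
  simp only [hL, hg₁, hg₂, hg₃, hf₁, hf₂, hf₃, mul_add, add_mul, mul_assoc, smul_mul_assoc, mul_smul_comm, mul_zero,
    zero_mul, add_zero, zero_add, smul_zero, mul_neg, neg_neg, neg_zero, smul_neg,
    r21, r31, r32, s1, s2, ra1, rb1, rb2, rb3, hgg₃]

end Super

/-! ### §3 (c) The obstruction vector `v_κ` and `κ⌟ch`: `σ_q(v_κ) = 0` for all-pure split designs -/

section Deriv

variable {B M : Type*} [CommRing B] [Algebra ℚ B] [AddCommGroup M] [Module B M] [Module ℚ M]
  (D : Derivation ℚ B M)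

/-- **(c), the Leibniz identity**: for any derivation `D` of a commutative `ℚ`-algebra (`D = κ⌟` on the even cohomology),
signs `ε_a` and roots `r_a`: `(q+1)·Σ_a ε_a r_a^q·D(r_a) = D(Σ_a ε_a r_a^{q+1})` — i.e. `q!·σ_q(v_κ) = κ⌟((q+1)!·ch_{q+1}(G))/…`:
the `σ_q`-image of the obstruction vector `v_κ = (κ⌟r_a)_a` of a split design is `κ⌟ch_{q+1}` up to the factorials
(dictionary (c): `σ_q` on the block `Ext²(L_a, L_a) = H^{0,2}` is `ω ↦ ε_a ω ∧ r_a^q/q!`). [cite: BuchweitzFlenner2003, Def. 4.1] -/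
theorem sum_pow_smul_derivation {m : ℕ} (ε : Fin m → ℤ) (r : Fin m → B) (q : ℕ) :
    (q + 1) • ∑ a, ε a • (r a ^ q • D (r a)) = D (∑ a, ε a • r a ^ (q + 1)) := by
  rw [map_sum, Finset.smul_sum]
  refine Finset.sum_congr rfl fun a _ => ?_
  rw [map_zsmul, Derivation.leibniz_pow, Nat.add_sub_cancel, smul_comm (q + 1) (ε a)]

/-- **(c) WTO, the vanishing**: if `ch_{q+1}` of the split design is ALL-PURE, `Σ_a ε_a r_a^{q+1} = c₀N^{q+1} + c₁w₁ + c₂w₂`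
with `D N = 0` (polarised direction, (a)) and `D w₁ = D w₂ = 0` (the Weil classes stay Hodge, (b)), then
`Σ_a ε_a r_a^q·D(r_a) = 0`: the obstruction vector `v_κ` lies in `ker σ_q` for every `q` — so, with `rank(κ ↦ v_κ) = 3` on
`T𝒲/T𝒯` for a charged design, `dim ker σ_I ≥ 3` for every `I` (LADDER C64 (c): no split all-pure design at a generic tensor
point is `I`-semiregular). [cite: BuchweitzFlenner2003, §5 (I-semiregular)] -/
theorem sigma_obstruction_eq_zero {m : ℕ} (ε : Fin m → ℤ) (r : Fin m → B) (q : ℕ)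
    (N w₁ w₂ : B) (hN : D N = 0) (hw₁ : D w₁ = 0) (hw₂ : D w₂ = 0) (c₀ c₁ c₂ : ℚ)
    (hpure : ∑ a, ε a • r a ^ (q + 1) = c₀ • N ^ (q + 1) + c₁ • w₁ + c₂ • w₂) :
    ∑ a, ε a • (r a ^ q • D (r a)) = 0 := by
  have h := sum_pow_smul_derivation D ε r q
  rw [hpure] at h
  simp only [map_add, Derivation.map_smul, Derivation.leibniz_pow, hN, hw₁, hw₂, smul_zero, add_zero] at h
  -- h : (q + 1) • Σ = 0
  have h' : ((q + 1 : ℕ) : ℚ) • ∑ a, ε a • (r a ^ q • D (r a)) = 0 := by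
    rw [Nat.cast_smul_eq_nsmul]; exact h
  have hq : ((q + 1 : ℕ) : ℚ) ≠ 0 := by positivity
  calc ∑ a, ε a • (r a ^ q • D (r a))
      = ((q + 1 : ℕ) : ℚ)⁻¹ • (((q + 1 : ℕ) : ℚ) • ∑ a, ε a • (r a ^ q • D (r a))) := by
        rw [smul_smul, inv_mul_cancel₀ hq, one_smul]
    _ = 0 := by rw [h', smul_zero]

end Deriv


/-! ### §4 (b′) Rank 3: the contraction of a charged root detects every transverse direction -/

section Rank

variable {F : Type*} [Field F] (d μ α β γ : F) (A B : Matrix (Fin 3) (Fin 3) F)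

/-- **(b′) the contraction of a root class along a Weil tangent vector.** For `K = [[A, B], [−dB, A]]` (`A` symmetric,
`B` antisymmetric) and the root `r = αN + βY + γX ↔ h_r = [[α+β+γ, μ(β−γ)], [μ(β−γ), d(α−β−γ)]] ⊗ 1`, the coefficient
matrix `K·h_r − (K·h_r)ᵀ` of the `(0,2)`-form `κ⌟r` is `[[2μ(β−γ)B, −2d(β+γ)B], [−2d(β+γ)B, −2dμ(β−γ)B]]`: only the
transverse part `B` contributes. [cite: vanGeemen1994HodgeAV, 5.2] -/
theorem contract_root_matrix (hA : Aᵀ = A) (hB : Bᵀ = -B) :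
    fromBlocks A B (-(d • B)) A *
          fromBlocks ((α + β + γ) • (1 : Matrix (Fin 3) (Fin 3) F)) ((μ * (β - γ)) • 1) ((μ * (β - γ)) • 1)
            ((d * (α - β - γ)) • 1) -
        (fromBlocks A B (-(d • B)) A *
          fromBlocks ((α + β + γ) • (1 : Matrix (Fin 3) (Fin 3) F)) ((μ * (β - γ)) • 1) ((μ * (β - γ)) • 1)
            ((d * (α - β - γ)) • 1))ᵀ =
      fromBlocks ((2 * μ * (β - γ)) • B) (-(2 * d * (β + γ)) • B) (-(2 * d * (β + γ)) • B)
        (-(2 * d * μ * (β - γ)) • B) := by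
  simp only [fromBlocks_multiply, Matrix.mul_smul, Matrix.mul_one, fromBlocks_transpose, transpose_smul,
    transpose_add, transpose_neg, hA, hB, smul_neg, sub_eq_add_neg, fromBlocks_neg, fromBlocks_add, fromBlocks_inj,
    neg_add, neg_neg]
  refine ⟨?_, ?_, ?_, ?_⟩ <;> module

/-- **(b′) rank 3.** If the root is charged (`β ≠ 0` or `γ ≠ 0`) and `2, d, μ ≠ 0`, the matrix of `contract_root_matrix`
vanishes only for `B = 0`: `κ ↦ κ⌟r` is injective on `T𝒲/T𝒯` (rank `3`), so the obstruction vector `v_κ = (κ⌟r_a)_a` of a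
design with one charged root spans a 3-dimensional subspace of `ker σ_I` (LADDER C64 (c)). [cite: vanGeemen1994HodgeAV, 5.2] -/
theorem eq_zero_of_contract_root_eq_zero (h2 : (2 : F) ≠ 0) (hd : d ≠ 0) (hμ : μ ≠ 0) (hβγ : β ≠ 0 ∨ γ ≠ 0)
    (h : fromBlocks ((2 * μ * (β - γ)) • B) (-(2 * d * (β + γ)) • B) (-(2 * d * (β + γ)) • B)
        (-(2 * d * μ * (β - γ)) • B) = (0 : Matrix (Fin 3 ⊕ Fin 3) (Fin 3 ⊕ Fin 3) F)) :
    B = 0 := by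
  rw [← fromBlocks_zero, fromBlocks_inj] at h
  obtain ⟨h11, h12, -, -⟩ := h
  by_cases hsum : β + γ = 0
  · have hdiff : β - γ ≠ 0 := by
      intro hzero
      have hb : β = 0 := (mul_eq_zero.mp (by linear_combination hsum + hzero : (2 : F) * β = 0)).resolve_left h2
      have hc : γ = 0 := (mul_eq_zero.mp (by linear_combination hsum - hzero : (2 : F) * γ = 0)).resolve_left h2
      exact hβγ.elim (fun h => h hb) (fun h => h hc)
    have hcoef : 2 * μ * (β - γ) ≠ 0 := mul_ne_zero (mul_ne_zero h2 hμ) hdiff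
    exact (smul_eq_zero.mp h11).resolve_left hcoef
  · have hcoef : -(2 * d * (β + γ)) ≠ 0 := neg_ne_zero.mpr (mul_ne_zero (mul_ne_zero h2 hd) hsum)
    exact (smul_eq_zero.mp h12).resolve_left hcoef

end Rank

end Literature.AlgebraicGeometry.HodgeTheory.WeilClassTestTransverseObstruction
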